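import Mathlib
import HarnessLib

/-!
# Lie subalgebras of `𝔰𝔬(V)` containing `𝔰𝔬(V₁^⊥)` for an anisotropic plane `V₁`
# (Verbitsky's erratum, §2.1)

Topic `Literature/Dynamics/Homogeneous`; theorems only (no new notion, no named fact — D-0026). This
file PROVES the algebraic step of M. Verbitsky's classification of the intermediate subgroups
`SO⁺(a−2,b) ⊊ S ⊊ SO⁺(a,b)` [Verbitsky2017ErgodicErratum, §2.1], the classification that drives the
Ratner-theoretic case analysis behind the orbit-closure trichotomy
`Literature.Dynamics.Homogeneous.Verbitsky2017_orbitClosure_trichotomy_K3` (vendored as a named fact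
in `OrthogonalGroupOrbitClosures`; its elementary half is proved in `OrthogonalGroupOrbitClosuresProofs`).
The 2015 paper [Verbitsky2015Ergodic] had overlooked the intermediate subalgebra `𝔰𝔬(V₂)` below —
this is the content of the erratum.

**The statement (erratum §2.1, verbatim).** "Let `V = ℝ^{p+q}` be a vector space equipped with a
quadratic form of signature `(p, q)`, `V₁ ⊂ V` a positive 2-dimensional subspace, and
`V₀ = V₁^⊥`. The Lie algebra `𝔰𝔬(V₀)` is identified with a subalgebra of `𝔰𝔬(V)` acting trivially
on `V₁`. Consider a proper Lie subalgebra `𝔤 ⊊ 𝔰𝔬(V)` such that `𝔰𝔬(V₀) ⊊ 𝔤 ⊊ 𝔰𝔬(V)`. Then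
either `𝔤 = 𝔰𝔬(V₂)`, where `V₂ ⊂ V` is a `p+q−1`-dimensional subspace, `V₀ ⊊ V₂ ⊊ V`, or
`𝔤 = 𝔰𝔬(V₀) ⊕ 𝔰𝔬(V₁)`." (There `a = p > 2`, `b = q > 0`, `a + b > 4`.)

**Rendering.** `V` is a finite-dimensional vector space over a field `𝕜` with `2 ≠ 0`, `B` a
non-degenerate symmetric bilinear form (`LinearMap.BilinForm`), `𝔰𝔬(V)` is Mathlib's
`skewAdjointLieSubalgebra B` (for the commutator Lie structure `LieRing.ofAssociativeRing` on
`Module.End 𝕜 V`, enabled as a local instance exactly as in Mathlib's `Algebra/Lie/SkewAdjoint`),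
`V₁ : Submodule 𝕜 V` is a plane (`finrank V₁ = 2`) which is ANISOTROPIC (`B v v = 0 → v = 0` on
`V₁` — e.g. positive definite over `ℝ`; for an isotropic plane the statement is false: the
stabiliser of an isotropic line of `V₁` is a further intermediate subalgebra), `dim V ≥ 5`
(= `a + b > 4`; so `dim V₀ ≥ 3`), `V₀ = B.orthogonal V₁`, and `𝔰𝔬(V₀) ⊆ 𝔰𝔬(V)` = the skew
endomorphisms killing `V₁` (they preserve `V₀ = V₁^⊥` and restrict there to `𝔰𝔬(V₀)`). The
conclusion is given as the complete list of the Lie subalgebras `𝔤` with `𝔰𝔬(V₀) ⊆ 𝔤 ⊆ 𝔰𝔬(V)`,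
each described by a membership condition on skew `f`: `f(V₁) = 0` (`𝔰𝔬(V₀)`); `f(V₁) ⊆ V₁`
(`𝔰𝔬(V₀) ⊕ 𝔰𝔬(V₁)`); `f s = 0` for a fixed `s ∈ V₁ ∖ 0` (`𝔰𝔬(V₂)`, `V₂ = s^⊥ ⊋ V₀` a hyperplane);
no condition (`𝔰𝔬(V)`) — `Verbitsky2017_lieSubalgebra_containing_so_orthogonal`; the printed
two-case form under proper containments is `Verbitsky2017_properIntermediateSubalgebra`.

**The proof** is the printed two-step argument made elementary and basis-free. Elements of `𝔰𝔬(V)`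
are handled through the elementary skew maps `u ∧ w : x ↦ B(w,x) u − B(u,x) w` (local notation
`ω⟦B; u, w⟧`): `𝔰𝔬(V) = 𝔰𝔬(V₀) ⊕ (V₀ ⊗ V₁) ⊕ 𝔰𝔬(V₁)` becomes "every skew `f` is its diagonal part
`π₀ f π₀ ∈ 𝔰𝔬(V₀)` plus two wedges `qᵢ⁻¹ (π₀ f eᵢ) ∧ eᵢ` plus a rotation" (`SkewPlane.diag_mem`,
`SkewPlane.sub_bwedges_rot`, `SkewPlane.eq_bwedge_add_bwedge`); Step 1 (the `𝔰𝔬(V₀)`-submodules of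
`V₀ ⊗ V₁ ≅ V₀ ⊕ V₀` are the `V₀ ⊗ R₁`, by irreducibility of `V₀`) is `SkewPlane.orthogonal_le_of_stable` (a
subspace containing all `(u ∧ w) a` for one `a ≠ 0` and stable under the wedges of `V₀` contains
`V₀`; uses `dim V₀ ≥ 3` and non-degeneracy) and `SkewPlane.bwedge_mem_of_rank_one`; Step 2
(bracket closure: `[u ∧ e, u' ∧ e'] = −B(e,e') u ∧ u' − B(u,u') e ∧ e'`,
`SkewPlane.bwedge_lie_bwedge`) sorts the four cases in the main proof, the rotations `𝔰𝔬(V₁)`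
being a line (`SkewPlane.exists_rot_eq_smul`). All helpers live in the sub-namespace `SkewPlane`.

Deliberately NOT here: Lie groups (the passage from Lie subalgebras to closed connected subgroups
is the Lie correspondence, not in Mathlib); the isotropic-plane variant; infinite dimension.

## References

* [Verbitsky2017ErgodicErratum] M. Verbitsky, Ergodic complex structures on hyperkähler manifolds:
  an erratum, arXiv:1708.05802 (2017), §2.1 (the Proposition "Lie subalgebras
  `𝔰𝔬(a−2,b) ⊊ 𝔤 ⊊ 𝔰𝔬(a,b)`" and its proof, Steps 1–2).
* [Verbitsky2015Ergodic] M. Verbitsky, Ergodic complex structures on hyperkähler manifolds, Acta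
  Math. 215 (2015) (the statement corrected by the erratum).
-/

noncomputable section

attribute [local instance 100] LieRing.ofAssociativeRing

namespace Literature.Dynamics.Homogeneous

open Module

variable {𝕜 : Type*} [Field 𝕜] {V : Type*} [AddCommGroup V] [Module 𝕜 V]

-- The elementary skew endomorphism `u ∧_B w : x ↦ B(w,x) u − B(u,x) w` (local notation).
local notation "ω⟦" B "; " u ", " w "⟧" =>
  (LinearMap.smulRight (B w) u - LinearMap.smulRight (B u) w)

/-! ## Linear algebra of the configuration `(B, V₁)` (helpers, grouped under `SkewPlane`) -/

namespace SkewPlane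

/-- The wedge `u ∧ w` acts by `x ↦ B(w,x) u − B(u,x) w`. [folklore] -/
theorem bwedge_apply (B : LinearMap.BilinForm 𝕜 V) (u w x : V) :
    (ω⟦B; u, w⟧ : Module.End 𝕜 V) x = B w x • u - B u x • w := rfl

/-- Membership in Mathlib's `𝔰𝔬(V) = skewAdjointLieSubalgebra B`: `B(f x, y) = −B(x, f y)`. [folklore] -/
theorem mem_skewAdjointLieSubalgebra_iff (B : LinearMap.BilinForm 𝕜 V) (f : Module.End 𝕜 V) :
    f ∈ skewAdjointLieSubalgebra B ↔ ∀ x y, B (f x) y = -B x (f y) := by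
  have : f ∈ skewAdjointLieSubalgebra B ↔ f ∈ B.skewAdjointSubmodule := Iff.rfl
  rw [this, LinearMap.mem_skewAdjointSubmodule]
  simp only [LinearMap.IsSkewAdjoint, LinearMap.IsAdjointPair, Pi.neg_apply, map_neg]

/-- Wedges are skew for a symmetric form. [folklore] -/
theorem bwedge_skew {B : LinearMap.BilinForm 𝕜 V} (hB : B.IsSymm) (u w : V) :
    ∀ x y, B ((ω⟦B; u, w⟧ : Module.End 𝕜 V) x) y = -B x ((ω⟦B; u, w⟧ : Module.End 𝕜 V) y) := by
  intro x y
  simp only [LinearMap.sub_apply, LinearMap.smulRight_apply, map_sub, map_smul, LinearMap.smul_apply,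
    smul_eq_mul]
  rw [hB.eq x u, hB.eq x w]
  ring

/-- The commutator bracket of endomorphisms, pointwise. [folklore] -/
theorem end_lie_apply (f g : Module.End 𝕜 V) (x : V) : ⁅f, g⁆ x = f (g x) - g (f x) := by
  rw [Ring.lie_def]
  rfl

/-- `[f, u ∧ w] = f u ∧ w + u ∧ f w` for skew `f` (the wedges form an `𝔰𝔬(V)`-equivariant image of
`Λ² V`). [folklore] -/
theorem lie_bwedge {B : LinearMap.BilinForm 𝕜 V} {f : Module.End 𝕜 V}
    (hf : ∀ x y, B (f x) y = -B x (f y)) (u w : V) :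
    ⁅f, (ω⟦B; u, w⟧ : Module.End 𝕜 V)⁆ = ω⟦B; f u, w⟧ + ω⟦B; u, f w⟧ := by
  ext x
  have h1 : B w (f x) = -B (f w) x := by rw [hf w x, neg_neg]
  have h2 : B u (f x) = -B (f u) x := by rw [hf u x, neg_neg]
  simp only [end_lie_apply, bwedge_apply, map_sub, map_smul, LinearMap.add_apply, h1, h2]
  module

/-- Linearity of the wedge in its first slot (scalars). [folklore] -/
theorem bwedge_smul_left (B : LinearMap.BilinForm 𝕜 V) (c : 𝕜) (u w : V) :
    (ω⟦B; c • u, w⟧ : Module.End 𝕜 V) = c • ω⟦B; u, w⟧ := by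
  ext x
  simp only [LinearMap.sub_apply, LinearMap.smulRight_apply, map_smul, LinearMap.smul_apply,
    smul_eq_mul]
  module

/-- Linearity of the wedge in its second slot (scalars). [folklore] -/
theorem bwedge_smul_right (B : LinearMap.BilinForm 𝕜 V) (c : 𝕜) (u w : V) :
    (ω⟦B; u, c • w⟧ : Module.End 𝕜 V) = c • ω⟦B; u, w⟧ := by
  ext x
  simp only [LinearMap.sub_apply, LinearMap.smulRight_apply, map_smul, LinearMap.smul_apply,
    smul_eq_mul]
  module

/-- Additivity of the wedge in its second slot. [folklore] -/
theorem bwedge_add_right (B : LinearMap.BilinForm 𝕜 V) (u w w' : V) :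
    (ω⟦B; u, w + w'⟧ : Module.End 𝕜 V) = ω⟦B; u, w⟧ + ω⟦B; u, w'⟧ := by
  ext x
  simp only [LinearMap.sub_apply, LinearMap.smulRight_apply, map_add, LinearMap.add_apply]
  module

/-- Additivity of the wedge in its first slot. [folklore] -/
theorem bwedge_add_left (B : LinearMap.BilinForm 𝕜 V) (u u' w : V) :
    (ω⟦B; u + u', w⟧ : Module.End 𝕜 V) = ω⟦B; u, w⟧ + ω⟦B; u', w⟧ := by
  ext x
  simp only [LinearMap.sub_apply, LinearMap.smulRight_apply, map_add, LinearMap.add_apply]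
  module

/-- `u ∧ u = 0`. [folklore] -/
theorem bwedge_self (B : LinearMap.BilinForm 𝕜 V) (u : V) :
    (ω⟦B; u, u⟧ : Module.End 𝕜 V) = 0 := sub_self _

/-- Antisymmetry `w ∧ u = −(u ∧ w)`. [folklore] -/
theorem bwedge_swap (B : LinearMap.BilinForm 𝕜 V) (u w : V) :
    (ω⟦B; w, u⟧ : Module.End 𝕜 V) = -ω⟦B; u, w⟧ := (neg_sub _ _).symm

/-- Bracket of two wedges with orthogonal cross terms. [folklore] -/
theorem bwedge_lie_bwedge {B : LinearMap.BilinForm 𝕜 V} (hB : B.IsSymm) {u u' e e' : V}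
    (hue' : B u e' = 0) (heu' : B e u' = 0) :
    ⁅(ω⟦B; u, e⟧ : Module.End 𝕜 V), (ω⟦B; u', e'⟧ : Module.End 𝕜 V)⁆ =
      -(B e e') • ω⟦B; u, u'⟧ - (B u u') • ω⟦B; e, e'⟧ := by
  ext x
  have h3 : B e' u = 0 := by rw [hB.eq]; exact hue'
  have h4 : B u' e = 0 := by rw [hB.eq]; exact heu'
  simp only [end_lie_apply, LinearMap.sub_apply, LinearMap.smulRight_apply, map_sub, map_smul,
    LinearMap.smul_apply, hue', heu', h3, h4]
  rw [hB.eq e' e, hB.eq u' u]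
  module

/-! ### Dimension helpers -/

/-- In a subspace of dimension `≥ 3` two linear functionals have a common non-zero zero.
[folklore] -/
theorem exists_ne_zero_mem_ker₂ [FiniteDimensional 𝕜 V] (W : Submodule 𝕜 V)
    (hW : 3 ≤ finrank 𝕜 W) (φ ψ : V →ₗ[𝕜] 𝕜) :
    ∃ u ∈ W, u ≠ 0 ∧ φ u = 0 ∧ ψ u = 0 := by
  set F : W →ₗ[𝕜] 𝕜 × 𝕜 := (φ.prod ψ).comp W.subtype with hF
  have hlt : finrank 𝕜 (𝕜 × 𝕜) < finrank 𝕜 W := by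
    rw [Module.finrank_prod, Module.finrank_self]; omega
  obtain ⟨x, hx, hx0⟩ :=
    (Submodule.ne_bot_iff _).1 (LinearMap.ker_ne_bot_of_finrank_lt (f := F) hlt)
  have hx' : F x = 0 := LinearMap.mem_ker.1 hx
  rw [hF, LinearMap.comp_apply, Submodule.subtype_apply, LinearMap.prod_apply] at hx'
  refine ⟨x, x.2, fun h => hx0 (Subtype.ext h), ?_, ?_⟩
  · exact congr_arg Prod.fst hx'
  · exact congr_arg Prod.snd hx'

/-- In a subspace of dimension `≥ 2` a linear functional has a non-zero zero. [folklore] -/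
theorem exists_ne_zero_mem_ker₁ [FiniteDimensional 𝕜 V] (W : Submodule 𝕜 V)
    (hW : 2 ≤ finrank 𝕜 W) (φ : V →ₗ[𝕜] 𝕜) :
    ∃ u ∈ W, u ≠ 0 ∧ φ u = 0 := by
  set F : W →ₗ[𝕜] 𝕜 := φ.comp W.subtype with hF
  have hlt : finrank 𝕜 𝕜 < finrank 𝕜 W := by rw [Module.finrank_self]; omega
  obtain ⟨x, hx, hx0⟩ :=
    (Submodule.ne_bot_iff _).1 (LinearMap.ker_ne_bot_of_finrank_lt (f := F) hlt)
  have hx' : F x = 0 := LinearMap.mem_ker.1 hx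
  rw [hF, LinearMap.comp_apply, Submodule.subtype_apply] at hx'
  exact ⟨x, x.2, fun h => hx0 (Subtype.ext h), hx'⟩

section Setting

variable [FiniteDimensional 𝕜 V] {B : LinearMap.BilinForm 𝕜 V} {V₁ : Submodule 𝕜 V}

omit [FiniteDimensional 𝕜 V] in
/-- An anisotropic plane is non-degenerate. [folklore] -/
theorem restrict_nondegenerate_of_anisotropic (hV₁ : ∀ v ∈ V₁, B v v = 0 → v = 0) :
    (B.restrict V₁).Nondegenerate := by
  refine ⟨fun x hx => ?_, fun y hy => ?_⟩
  · exact Submodule.coe_eq_zero.1 (hV₁ x x.2 (by simpa using hx x))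
  · exact Submodule.coe_eq_zero.1 (hV₁ y y.2 (by simpa using hy y))

/-- `V = V₁ ⊕ V₁^⊥` for an anisotropic `V₁` (Mathlib's
`isCompl_orthogonal_of_restrict_nondegenerate`). [folklore] -/
theorem isCompl_orthogonal_of_anisotropic (hB : B.IsSymm)
    (hV₁ : ∀ v ∈ V₁, B v v = 0 → v = 0) : IsCompl V₁ (B.orthogonal V₁) :=
  LinearMap.BilinForm.isCompl_orthogonal_of_restrict_nondegenerate hB.isRefl
    (restrict_nondegenerate_of_anisotropic hV₁)

omit [FiniteDimensional 𝕜 V] in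
/-- `B(e, v) = 0` for `e ∈ V₁`, `v ∈ V₁^⊥`. [folklore] -/
theorem B_eq_zero_of_mem_of_mem_orthogonal {e v : V} (he : e ∈ V₁)
    (hv : v ∈ B.orthogonal V₁) : B e v = 0 :=
  (LinearMap.BilinForm.mem_orthogonal_iff.1 hv) e he

omit [FiniteDimensional 𝕜 V] in
/-- `B(v, e) = 0` for `e ∈ V₁`, `v ∈ V₁^⊥` (symmetric form). [folklore] -/
theorem B_eq_zero_of_mem_orthogonal_of_mem (hB : B.IsSymm) {e v : V} (he : e ∈ V₁)
    (hv : v ∈ B.orthogonal V₁) : B v e = 0 := by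
  rw [hB.eq]; exact B_eq_zero_of_mem_of_mem_orthogonal he hv

/-- `dim V₁^⊥ = dim V − 2 ≥ 3`. [folklore] -/
theorem three_le_finrank_orthogonal (hBn : B.Nondegenerate) (h2 : finrank 𝕜 V₁ = 2)
    (h5 : 5 ≤ finrank 𝕜 V) : 3 ≤ finrank 𝕜 (B.orthogonal V₁) := by
  rw [LinearMap.BilinForm.finrank_orthogonal hBn, h2]; omega

/-- A vector of `V₀ = V₁^⊥` orthogonal to all of `V₀` vanishes. [folklore] -/
theorem eq_zero_of_mem_orthogonal_of_forall (hB : B.IsSymm) (hBn : B.Nondegenerate)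
    (hV₁ : ∀ v ∈ V₁, B v v = 0 → v = 0) {z : V} (hz : z ∈ B.orthogonal V₁)
    (h : ∀ w ∈ B.orthogonal V₁, B w z = 0) : z = 0 := by
  have hz1 : z ∈ B.orthogonal (B.orthogonal V₁) :=
    LinearMap.BilinForm.mem_orthogonal_iff.2 fun w hw => h w hw
  rw [LinearMap.BilinForm.orthogonal_orthogonal hBn hB.isRefl] at hz1
  have := (isCompl_orthogonal_of_anisotropic hB hV₁).disjoint
  exact (Submodule.disjoint_def.1 this) z hz1 hz

/-- Non-degeneracy of `V₀ = V₁^⊥`: every non-zero `a ∈ V₀` has a `w ∈ V₀` with `B(w,a) = 1`.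
[folklore] -/
theorem exists_B_eq_one (hB : B.IsSymm) (hBn : B.Nondegenerate)
    (hV₁ : ∀ v ∈ V₁, B v v = 0 → v = 0) {a : V} (ha : a ∈ B.orthogonal V₁) (ha0 : a ≠ 0) :
    ∃ w ∈ B.orthogonal V₁, B w a = 1 := by
  obtain ⟨w, hw, hne⟩ : ∃ w ∈ B.orthogonal V₁, B w a ≠ 0 := by
    by_contra hcon
    refine ha0 (eq_zero_of_mem_orthogonal_of_forall hB hBn hV₁ ha fun w hw => ?_)
    by_contra hne
    exact hcon ⟨w, hw, hne⟩
  refine ⟨(B w a)⁻¹ • w, Submodule.smul_mem _ _ hw, ?_⟩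
  rw [map_smul, LinearMap.smul_apply, smul_eq_mul, inv_mul_cancel₀ hne]

/-- In the anisotropic plane `V₁`, the orthogonal of a non-zero `e` is the line of any non-zero
`z ⊥ e`. [folklore] -/
theorem exists_smul_eq_of_B_eq_zero (hV₁ : ∀ v ∈ V₁, B v v = 0 → v = 0)
    (h2 : finrank 𝕜 V₁ = 2) {e z : V} (he : e ∈ V₁) (he0 : e ≠ 0) (hz : z ∈ V₁) (hz0 : z ≠ 0)
    (hez : B e z = 0) {y : V} (hy : y ∈ V₁) (hey : B e y = 0) : ∃ c : 𝕜, y = c • z := by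
  set L : Submodule 𝕜 V := V₁ ⊓ LinearMap.ker (B e) with hL
  have hzL : z ∈ L := ⟨hz, LinearMap.mem_ker.2 hez⟩
  have hyL : y ∈ L := ⟨hy, LinearMap.mem_ker.2 hey⟩
  have hq : B e e ≠ 0 := fun h => he0 (hV₁ e he h)
  -- `L ⊓ 𝕜 e = ⊥` and `L ⊔ 𝕜 e ≤ V₁`, so `finrank L ≤ 1`
  have hinf : L ⊓ (𝕜 ∙ e) = ⊥ := by
    rw [eq_bot_iff]
    rintro x ⟨hxL, hxe⟩
    obtain ⟨c, rfl⟩ := Submodule.mem_span_singleton.1 hxe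
    have : B e (c • e) = 0 := LinearMap.mem_ker.1 hxL.2
    rw [map_smul, smul_eq_mul, mul_eq_zero] at this
    rcases this with hc | hc
    · simp [hc]
    · exact (hq hc).elim
  have hsup : L ⊔ (𝕜 ∙ e) ≤ V₁ :=
    sup_le (fun x hx => hx.1) ((Submodule.span_singleton_le_iff_mem e V₁).2 he)
  have hdim := Submodule.finrank_sup_add_finrank_inf_eq L (𝕜 ∙ e)
  rw [hinf, finrank_bot, add_zero, finrank_span_singleton he0] at hdim
  have hle : finrank 𝕜 ↥(L ⊔ (𝕜 ∙ e)) ≤ 2 := h2 ▸ Submodule.finrank_mono hsup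
  have hL1 : finrank 𝕜 L ≤ finrank 𝕜 (𝕜 ∙ z) := by
    rw [finrank_span_singleton hz0]; omega
  have hzle : (𝕜 ∙ z) ≤ L := (Submodule.span_singleton_le_iff_mem z L).2 hzL
  have hEq : (𝕜 ∙ z) = L := Submodule.eq_of_le_of_finrank_le hzle hL1
  rw [← hEq] at hyL
  obtain ⟨c, rfl⟩ := Submodule.mem_span_singleton.1 hyL
  exact ⟨c, rfl⟩

/-- Existence of a non-zero vector of `V₁` orthogonal to a given one. [folklore] -/
theorem exists_orthogonal_mem (h2 : finrank 𝕜 V₁ = 2) (e : V) :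
    ∃ z ∈ V₁, z ≠ 0 ∧ B e z = 0 :=
  exists_ne_zero_mem_ker₁ V₁ (by omega) (B e)

/-- Orthogonal expansion in the anisotropic plane. [folklore] -/
theorem eq_smul_add_smul (hB : B.IsSymm) (hV₁ : ∀ v ∈ V₁, B v v = 0 → v = 0)
    (h2 : finrank 𝕜 V₁ = 2) {e z : V} (he : e ∈ V₁) (he0 : e ≠ 0) (hz : z ∈ V₁) (hz0 : z ≠ 0)
    (hez : B e z = 0) {x : V} (hx : x ∈ V₁) :
    x = ((B e e)⁻¹ * B e x) • e + ((B z z)⁻¹ * B z x) • z := by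
  have hq : B e e ≠ 0 := fun h => he0 (hV₁ e he h)
  have hq' : B z z ≠ 0 := fun h => hz0 (hV₁ z hz h)
  have hze : B z e = 0 := by rw [hB.eq]; exact hez
  set y := x - (((B e e)⁻¹ * B e x) • e + ((B z z)⁻¹ * B z x) • z) with hy
  have hyV : y ∈ V₁ := Submodule.sub_mem _ hx
    (Submodule.add_mem _ (Submodule.smul_mem _ _ he) (Submodule.smul_mem _ _ hz))
  have hey : B e y = 0 := by
    simp only [hy, map_sub, map_add, map_smul, smul_eq_mul, hez]
    field_simp; ring
  have hzy : B z y = 0 := by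
    simp only [hy, map_sub, map_add, map_smul, smul_eq_mul, hze]
    field_simp; ring
  obtain ⟨c, hc⟩ := exists_smul_eq_of_B_eq_zero hV₁ h2 he he0 hz hz0 hez hyV hey
  have : c = 0 := by
    rw [hc, map_smul, smul_eq_mul, mul_eq_zero] at hzy
    exact hzy.resolve_right hq'
  rw [this, zero_smul] at hc
  exact (sub_eq_zero.1 hc)

/-- An anisotropic vector exists in the non-degenerate `V₀` (characteristic `≠ 2`). [folklore] -/
theorem exists_anisotropic_mem_orthogonal [NeZero (2 : 𝕜)] (hB : B.IsSymm)
    (hBn : B.Nondegenerate) (hV₁ : ∀ v ∈ V₁, B v v = 0 → v = 0) (h2 : finrank 𝕜 V₁ = 2)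
    (h5 : 5 ≤ finrank 𝕜 V) : ∃ u ∈ B.orthogonal V₁, B u u ≠ 0 := by
  by_contra hcon
  have hcon' : ∀ u ∈ B.orthogonal V₁, B u u = 0 := fun u hu => by
    by_contra h
    exact hcon ⟨u, hu, h⟩
  have h3 := three_le_finrank_orthogonal hBn h2 h5
  obtain ⟨a, ha, ha0, -⟩ := exists_ne_zero_mem_ker₁ (B.orthogonal V₁) (by omega) (0 : V →ₗ[𝕜] 𝕜)
  obtain ⟨w, hw, hwa⟩ := exists_B_eq_one hB hBn hV₁ ha ha0
  have h1 := hcon' (a + w) (Submodule.add_mem _ ha hw)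
  simp only [map_add, LinearMap.add_apply, hcon' a ha, hcon' w hw, hwa, zero_add, add_zero] at h1
  rw [hB.eq a w, hwa, one_add_one_eq_two] at h1
  exact two_ne_zero h1


/-! ### Projections, diagonal parts, rotations -/

omit [FiniteDimensional 𝕜 V] in
/-- A skew endomorphism pairs every vector trivially with its image (characteristic `≠ 2`). [folklore] -/
theorem B_apply_self_eq_zero [NeZero (2 : 𝕜)] (hB : B.IsSymm) {j : Module.End 𝕜 V}
    (hj : j ∈ skewAdjointLieSubalgebra B) (x : V) : B x (j x) = 0 := by
  have h := (mem_skewAdjointLieSubalgebra_iff B j).1 hj x x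
  rw [hB.eq (j x) x] at h
  have h2 : B x (j x) + B x (j x) = 0 := by
    nth_rewrite 2 [h]
    exact add_neg_cancel _
  rw [← two_mul, mul_eq_zero] at h2
  exact h2.resolve_left two_ne_zero

omit [FiniteDimensional 𝕜 V] in
/-- A skew endomorphism mapping `V₀` into `V₁` and `V₁` into itself kills `V₀`. [folklore] -/
theorem apply_eq_zero_of_off_of_stable (hV₁ : ∀ v ∈ V₁, B v v = 0 → v = 0)
    {h : Module.End 𝕜 V} (hh : h ∈ skewAdjointLieSubalgebra B)
    (h0 : ∀ v ∈ B.orthogonal V₁, h v ∈ V₁) (h1 : ∀ e ∈ V₁, h e ∈ V₁) :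
    ∀ v ∈ B.orthogonal V₁, h v = 0 := by
  intro v hv
  have hh' := (mem_skewAdjointLieSubalgebra_iff B h).1 hh
  refine hV₁ _ (h0 v hv) ?_
  have := hh' (h v) v
  rw [B_eq_zero_of_mem_of_mem_orthogonal (h1 _ (h0 v hv)) hv] at this
  exact (neg_eq_zero.1 this.symm)

/-- A skew endomorphism killing `V₀` maps `V₁` into `V₁`. [folklore] -/
theorem apply_mem_of_rot (hB : B.IsSymm) (hBn : B.Nondegenerate) {j : Module.End 𝕜 V}
    (hj : j ∈ skewAdjointLieSubalgebra B) (hj0 : ∀ v ∈ B.orthogonal V₁, j v = 0) {e : V}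
    (_he : e ∈ V₁) : j e ∈ V₁ := by
  have hj' := (mem_skewAdjointLieSubalgebra_iff B j).1 hj
  have : j e ∈ B.orthogonal (B.orthogonal V₁) :=
    LinearMap.BilinForm.mem_orthogonal_iff.2 fun w hw => by
      have h := hj' w e
      rw [hj0 w hw, map_zero, LinearMap.zero_apply] at h
      show B w (j e) = 0
      exact neg_eq_zero.1 h.symm
  rwa [LinearMap.BilinForm.orthogonal_orthogonal hBn hB.isRefl] at this

/-- Decomposition of a vector along `V = V₁ ⊕ V₀`. [folklore] -/
theorem exists_add_eq (hB : B.IsSymm) (hV₁ : ∀ v ∈ V₁, B v v = 0 → v = 0) (x : V) :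
    ∃ y ∈ V₁, ∃ z ∈ B.orthogonal V₁, y + z = x :=
  Submodule.mem_sup.1 (by
    rw [(isCompl_orthogonal_of_anisotropic hB hV₁).sup_eq_top]; exact Submodule.mem_top)

/-- A "rotation" (skew, killing `V₀`) that kills a non-zero vector of `V₁` is zero. [folklore] -/
theorem rot_eq_zero [NeZero (2 : 𝕜)] (hB : B.IsSymm) (hBn : B.Nondegenerate)
    (hV₁ : ∀ v ∈ V₁, B v v = 0 → v = 0) (h2 : finrank 𝕜 V₁ = 2) {j : Module.End 𝕜 V}
    (hj : j ∈ skewAdjointLieSubalgebra B) (hj0 : ∀ v ∈ B.orthogonal V₁, j v = 0) {e : V}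
    (he : e ∈ V₁) (he0 : e ≠ 0) (hje : j e = 0) : j = 0 := by
  have hj' := (mem_skewAdjointLieSubalgebra_iff B j).1 hj
  obtain ⟨z, hz, hz0, hez⟩ := exists_orthogonal_mem (B := B) h2 e
  have hjz : j z = 0 := by
    have h1 : B e (j z) = 0 := by
      have := hj' e z
      rw [hje, map_zero, LinearMap.zero_apply] at this
      exact neg_eq_zero.1 this.symm
    have h2' : B z (j z) = 0 := B_apply_self_eq_zero hB hj z
    rw [eq_smul_add_smul hB hV₁ h2 he he0 hz hz0 hez (apply_mem_of_rot hB hBn hj hj0 hz), h1,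
      h2', mul_zero, mul_zero, zero_smul, zero_smul, add_zero]
  refine LinearMap.ext fun x => ?_
  obtain ⟨y, hy, w, hw, rfl⟩ := exists_add_eq hB hV₁ x
  rw [LinearMap.zero_apply, map_add, hj0 w hw, add_zero,
    eq_smul_add_smul hB hV₁ h2 he he0 hz hz0 hez hy, map_add, map_smul, map_smul, hje, hjz,
    smul_zero, smul_zero, add_zero]

/-- Rotations form a line: two rotations are proportional. [folklore] -/
theorem exists_rot_eq_smul [NeZero (2 : 𝕜)] (hB : B.IsSymm) (hBn : B.Nondegenerate)
    (hV₁ : ∀ v ∈ V₁, B v v = 0 → v = 0) (h2 : finrank 𝕜 V₁ = 2) {j j' : Module.End 𝕜 V}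
    (hj : j ∈ skewAdjointLieSubalgebra B) (hj0 : ∀ v ∈ B.orthogonal V₁, j v = 0) (hjne : j ≠ 0)
    (hj' : j' ∈ skewAdjointLieSubalgebra B) (hj'0 : ∀ v ∈ B.orthogonal V₁, j' v = 0) :
    ∃ c : 𝕜, j' = c • j := by
  obtain ⟨e, he, he0, -⟩ := exists_ne_zero_mem_ker₁ V₁ (by omega) (0 : V →ₗ[𝕜] 𝕜)
  have hje : j e ≠ 0 := fun h => hjne (rot_eq_zero hB hBn hV₁ h2 hj hj0 he he0 h)
  obtain ⟨c, hc⟩ := exists_smul_eq_of_B_eq_zero hV₁ h2 he he0 (apply_mem_of_rot hB hBn hj hj0 he)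
    hje (B_apply_self_eq_zero hB hj e) (apply_mem_of_rot hB hBn hj' hj'0 he)
    (B_apply_self_eq_zero hB hj' e)
  refine ⟨c, ?_⟩
  have hmem : j' - c • j ∈ skewAdjointLieSubalgebra B :=
    (skewAdjointLieSubalgebra B).sub_mem hj' ((skewAdjointLieSubalgebra B).smul_mem c hj)
  have := rot_eq_zero hB hBn hV₁ h2 hmem (fun v hv => by
    rw [LinearMap.sub_apply, LinearMap.smul_apply, hj0 v hv, hj'0 v hv, smul_zero, sub_zero])
    he he0 (by rw [LinearMap.sub_apply, LinearMap.smul_apply, hc, sub_self])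
  exact sub_eq_zero.1 this

/-! ### The projection `π₀` onto `V₀` along `V₁`, abstractly -/

section Proj

variable {π₀ : Module.End 𝕜 V}

/-- A projection onto `V₀` along `V₁` (abstractly: values in `V₀`, `x − π₀ x ∈ V₁`) fixes `V₀`.
[folklore] -/
theorem proj_apply_of_mem_orthogonal (hB : B.IsSymm) (hV₁ : ∀ v ∈ V₁, B v v = 0 → v = 0)
    (hπa : ∀ x, π₀ x ∈ B.orthogonal V₁) (hπb : ∀ x, x - π₀ x ∈ V₁) {v : V}
    (hv : v ∈ B.orthogonal V₁) : π₀ v = v := by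
  have h1 : v - π₀ v ∈ B.orthogonal V₁ := Submodule.sub_mem _ hv (hπa v)
  have := (Submodule.disjoint_def.1 (isCompl_orthogonal_of_anisotropic hB hV₁).disjoint)
    _ (hπb v) h1
  exact (sub_eq_zero.1 this).symm

/-- A projection onto `V₀` along `V₁` kills `V₁`. [folklore] -/
theorem proj_apply_of_mem (hB : B.IsSymm) (hV₁ : ∀ v ∈ V₁, B v v = 0 → v = 0)
    (hπa : ∀ x, π₀ x ∈ B.orthogonal V₁) (hπb : ∀ x, x - π₀ x ∈ V₁) {e : V} (he : e ∈ V₁) :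
    π₀ e = 0 := by
  have h1 : π₀ e ∈ V₁ := by
    have := Submodule.sub_mem _ he (hπb e)
    rwa [sub_sub_cancel] at this
  exact (Submodule.disjoint_def.1 (isCompl_orthogonal_of_anisotropic hB hV₁).disjoint) _ h1 (hπa e)

omit [FiniteDimensional 𝕜 V] in
/-- The projection onto `V₀` along `V₁ ⊥ V₀` is `B`-self-adjoint (left form). [folklore] -/
theorem B_proj_left (hB : B.IsSymm) (hπa : ∀ x, π₀ x ∈ B.orthogonal V₁)
    (hπb : ∀ x, x - π₀ x ∈ V₁) (x y : V) : B (π₀ x) y = B (π₀ x) (π₀ y) := by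
  calc B (π₀ x) y = B (π₀ x) (π₀ y + (y - π₀ y)) := by congr 1; abel
    _ = B (π₀ x) (π₀ y) := by
      rw [map_add, B_eq_zero_of_mem_orthogonal_of_mem hB (hπb y) (hπa x), add_zero]

omit [FiniteDimensional 𝕜 V] in
/-- The projection onto `V₀` along `V₁ ⊥ V₀` is `B`-self-adjoint (right form). [folklore] -/
theorem B_proj_right (hπa : ∀ x, π₀ x ∈ B.orthogonal V₁)
    (hπb : ∀ x, x - π₀ x ∈ V₁) (x y : V) : B x (π₀ y) = B (π₀ x) (π₀ y) := by
  calc B x (π₀ y) = B (π₀ x + (x - π₀ x)) (π₀ y) := by congr 2; abel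
    _ = B (π₀ x) (π₀ y) := by
      rw [map_add, LinearMap.add_apply, B_eq_zero_of_mem_of_mem_orthogonal (hπb x) (hπa y),
        add_zero]

/-- The `V₀`-diagonal part `π₀ f π₀` of a skew `f` is skew and kills `V₁`. [folklore] -/
theorem diag_mem (hB : B.IsSymm) (hV₁ : ∀ v ∈ V₁, B v v = 0 → v = 0)
    (hπa : ∀ x, π₀ x ∈ B.orthogonal V₁) (hπb : ∀ x, x - π₀ x ∈ V₁)
    {f : Module.End 𝕜 V} (hf : f ∈ skewAdjointLieSubalgebra B) :
    π₀ * f * π₀ ∈ skewAdjointLieSubalgebra B ∧ ∀ e ∈ V₁, (π₀ * f * π₀) e = 0 := by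
  have hf' := (mem_skewAdjointLieSubalgebra_iff B f).1 hf
  refine ⟨(mem_skewAdjointLieSubalgebra_iff B _).2 fun x y => ?_, fun e he => ?_⟩
  · simp only [Module.End.mul_apply]
    rw [B_proj_left hB hπa hπb, ← B_proj_right hπa hπb, hf', B_proj_left hB hπa hπb (x := x),
      ← B_proj_right hπa hπb]
  · simp only [Module.End.mul_apply]
    rw [proj_apply_of_mem hB hV₁ hπa hπb he, map_zero, map_zero]

/-- Removing the diagonal part: `f - π₀ f π₀` maps `V₀` into `V₁` and agrees with `f` on `V₁`. [folklore] -/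
theorem off_of_sub_diag (hB : B.IsSymm) (hV₁ : ∀ v ∈ V₁, B v v = 0 → v = 0)
    (hπa : ∀ x, π₀ x ∈ B.orthogonal V₁) (hπb : ∀ x, x - π₀ x ∈ V₁) (f : Module.End 𝕜 V) :
    (∀ v ∈ B.orthogonal V₁, (f - π₀ * f * π₀) v ∈ V₁) ∧
      ∀ e ∈ V₁, (f - π₀ * f * π₀) e = f e := by
  refine ⟨fun v hv => ?_, fun e he => ?_⟩
  · rw [LinearMap.sub_apply, Module.End.mul_apply, Module.End.mul_apply,
      proj_apply_of_mem_orthogonal hB hV₁ hπa hπb hv]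
    exact hπb _
  · rw [LinearMap.sub_apply, Module.End.mul_apply, Module.End.mul_apply,
      proj_apply_of_mem hB hV₁ hπa hπb he, map_zero, map_zero, sub_zero]

end Proj

/-! ### Off-diagonal elements: brackets with `so(V₀)`, representation, the engine -/

omit [FiniteDimensional 𝕜 V] in
/-- A wedge of two vectors of `V₀` kills `V₁`. [folklore] -/
theorem bwedge_apply_of_mem (hB : B.IsSymm) {u w e : V} (hu : u ∈ B.orthogonal V₁)
    (hw : w ∈ B.orthogonal V₁) (he : e ∈ V₁) : (ω⟦B; u, w⟧ : Module.End 𝕜 V) e = 0 := by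
  rw [bwedge_apply, B_eq_zero_of_mem_orthogonal_of_mem hB he hw,
    B_eq_zero_of_mem_orthogonal_of_mem hB he hu, zero_smul, zero_smul, sub_zero]

omit [FiniteDimensional 𝕜 V] in
/-- Wedges of vectors of `V₀` lie in `so(V₀) ⊆ 𝔤`. [folklore] -/
theorem bwedge_mem (hB : B.IsSymm) {𝔤 : LieSubalgebra 𝕜 (Module.End 𝕜 V)}
    (hann : ∀ f ∈ skewAdjointLieSubalgebra B, (∀ v ∈ V₁, f v = 0) → f ∈ 𝔤)
    {u w : V} (hu : u ∈ B.orthogonal V₁) (hw : w ∈ B.orthogonal V₁) :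
    (ω⟦B; u, w⟧ : Module.End 𝕜 V) ∈ 𝔤 :=
  hann _ ((mem_skewAdjointLieSubalgebra_iff B _).2 (bwedge_skew hB u w))
    fun _ he => bwedge_apply_of_mem hB hu hw he

omit [FiniteDimensional 𝕜 V] in
/-- The bracket of a `V₀`-off-diagonal skew `g` with a wedge of `V₀` is fully off-diagonal, and its
values on `V₁` are the wedge applied to the values of `g`. [folklore] -/
theorem lie_bwedge_off (hB : B.IsSymm) {g : Module.End 𝕜 V}
    (hgs : g ∈ skewAdjointLieSubalgebra B) (hg0 : ∀ v ∈ B.orthogonal V₁, g v ∈ V₁)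
    {u w : V} (hu : u ∈ B.orthogonal V₁) (hw : w ∈ B.orthogonal V₁) :
    ⁅(ω⟦B; u, w⟧ : Module.End 𝕜 V), g⁆ ∈ skewAdjointLieSubalgebra B ∧
    (∀ v ∈ B.orthogonal V₁, ⁅(ω⟦B; u, w⟧ : Module.End 𝕜 V), g⁆ v ∈ V₁) ∧
    (∀ e ∈ V₁, ⁅(ω⟦B; u, w⟧ : Module.End 𝕜 V), g⁆ e ∈ B.orthogonal V₁) ∧
    (∀ e ∈ V₁, ⁅(ω⟦B; u, w⟧ : Module.End 𝕜 V), g⁆ e = (ω⟦B; u, w⟧ : Module.End 𝕜 V) (g e)) := by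
  have hY : (ω⟦B; u, w⟧ : Module.End 𝕜 V) ∈ skewAdjointLieSubalgebra B :=
    (mem_skewAdjointLieSubalgebra_iff B _).2 (bwedge_skew hB u w)
  have hYV₀ : ∀ x, (ω⟦B; u, w⟧ : Module.End 𝕜 V) x ∈ B.orthogonal V₁ := fun x => by
    rw [bwedge_apply]
    exact Submodule.sub_mem _ (Submodule.smul_mem _ _ hu) (Submodule.smul_mem _ _ hw)
  have hval : ∀ e ∈ V₁, ⁅(ω⟦B; u, w⟧ : Module.End 𝕜 V), g⁆ e =
      (ω⟦B; u, w⟧ : Module.End 𝕜 V) (g e) := fun e he => by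
    rw [end_lie_apply, bwedge_apply_of_mem hB hu hw he, map_zero, sub_zero]
  refine ⟨(skewAdjointLieSubalgebra B).lie_mem hY hgs, fun v hv => ?_, fun e he => ?_, hval⟩
  · rw [end_lie_apply, bwedge_apply_of_mem hB hu hw (hg0 v hv), zero_sub]
    exact Submodule.neg_mem _ (hg0 _ (hYV₀ v))
  · rw [hval e he]; exact hYV₀ _

/-- Representation of a fully off-diagonal skew `k` by its values on an orthogonal basis
`e₁, e₂` of `V₁`: `k = q₁⁻¹ (k e₁ ∧ e₁) + q₂⁻¹ (k e₂ ∧ e₂)`. [folklore] -/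
theorem eq_bwedge_add_bwedge (hB : B.IsSymm) (hV₁ : ∀ v ∈ V₁, B v v = 0 → v = 0)
    (h2 : finrank 𝕜 V₁ = 2) {k : Module.End 𝕜 V} (hk : k ∈ skewAdjointLieSubalgebra B)
    (hk0 : ∀ v ∈ B.orthogonal V₁, k v ∈ V₁) (hk1 : ∀ e ∈ V₁, k e ∈ B.orthogonal V₁)
    {e₁ e₂ : V} (he₁ : e₁ ∈ V₁) (he₁0 : e₁ ≠ 0) (he₂ : e₂ ∈ V₁) (he₂0 : e₂ ≠ 0)
    (h12 : B e₁ e₂ = 0) :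
    k = (B e₁ e₁)⁻¹ • ω⟦B; k e₁, e₁⟧ + (B e₂ e₂)⁻¹ • ω⟦B; k e₂, e₂⟧ := by
  have hk' := (mem_skewAdjointLieSubalgebra_iff B k).1 hk
  refine LinearMap.ext fun x => ?_
  obtain ⟨y, hy, z, hz, rfl⟩ := exists_add_eq hB hV₁ x
  have hy' : k y = ((B e₁ e₁)⁻¹ * B e₁ y) • k e₁ + ((B e₂ e₂)⁻¹ * B e₂ y) • k e₂ := by
    conv_lhs => rw [eq_smul_add_smul hB hV₁ h2 he₁ he₁0 he₂ he₂0 h12 hy]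
    rw [map_add, map_smul, map_smul]
  have h1y : B (k e₁) y = 0 := B_eq_zero_of_mem_orthogonal_of_mem hB hy (hk1 e₁ he₁)
  have h2y : B (k e₂) y = 0 := B_eq_zero_of_mem_orthogonal_of_mem hB hy (hk1 e₂ he₂)
  have h1z : B e₁ z = 0 := B_eq_zero_of_mem_of_mem_orthogonal he₁ hz
  have h2z : B e₂ z = 0 := B_eq_zero_of_mem_of_mem_orthogonal he₂ hz
  have h3z : B (k e₁) z = -B e₁ (k z) := hk' e₁ z
  have h4z : B (k e₂) z = -B e₂ (k z) := hk' e₂ z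
  have hkz : k z ∈ V₁ := hk0 z hz
  rw [map_add, hy']
  generalize k z = m at h3z h4z hkz ⊢
  have hm := eq_smul_add_smul hB hV₁ h2 he₁ he₁0 he₂ he₂0 h12 hkz
  conv_lhs => rw [hm]
  simp only [LinearMap.add_apply, LinearMap.smul_apply, LinearMap.sub_apply,
    LinearMap.smulRight_apply, map_add, h1y, h2y, h1z, h2z, h3z, h4z]
  module

/-- **The engine** (irreducibility of `V₀` under `so(V₀)` in the form used here): a subspace
containing all `(u ∧ w) a` for a fixed non-zero `a ∈ V₀` and stable under all `u ∧ w`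
(`u, w ∈ V₀`) contains `V₀`. Uses `dim V₀ ≥ 3` and non-degeneracy of `V₀`. [folklore] -/
theorem orthogonal_le_of_stable (hB : B.IsSymm) (hBn : B.Nondegenerate)
    (hV₁ : ∀ v ∈ V₁, B v v = 0 → v = 0) (h2 : finrank 𝕜 V₁ = 2) (h5 : 5 ≤ finrank 𝕜 V)
    (S : Submodule 𝕜 V) {a : V} (ha : a ∈ B.orthogonal V₁) (ha0 : a ≠ 0)
    (hS1 : ∀ u ∈ B.orthogonal V₁, ∀ w ∈ B.orthogonal V₁, (ω⟦B; u, w⟧ : Module.End 𝕜 V) a ∈ S)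
    (hS2 : ∀ u ∈ B.orthogonal V₁, ∀ w ∈ B.orthogonal V₁, ∀ x ∈ S,
      (ω⟦B; u, w⟧ : Module.End 𝕜 V) x ∈ S) :
    B.orthogonal V₁ ≤ S := by
  obtain ⟨w, hw, hwa⟩ := exists_B_eq_one hB hBn hV₁ ha ha0
  have hA : ∀ u ∈ B.orthogonal V₁, B u a = 0 → u ∈ S := fun u hu hua => by
    have := hS1 u hu w hw
    rwa [bwedge_apply, hwa, hua, one_smul, zero_smul, sub_zero] at this
  obtain ⟨a', ha', ha'0, h1, h1'⟩ := exists_ne_zero_mem_ker₂ (B.orthogonal V₁)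
    (three_le_finrank_orthogonal hBn h2 h5) (B a) (B w)
  have ha'S : a' ∈ S := hA a' ha' (by rw [hB.eq]; exact h1)
  obtain ⟨w', hw', hw'a'⟩ := exists_B_eq_one hB hBn hV₁ ha' ha'0
  have hBst : ∀ u ∈ B.orthogonal V₁, B u a' = 0 → u ∈ S := fun u hu hua' => by
    have := hS2 u hu w' hw' a' ha'S
    rwa [bwedge_apply, hw'a', hua', one_smul, zero_smul, sub_zero] at this
  have hwS : w ∈ S := hBst w hw h1'
  intro x hx
  have hx1 : x - B x a • w ∈ S := by
    refine hA _ (Submodule.sub_mem _ hx (Submodule.smul_mem _ _ hw)) ?_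
    rw [map_sub, map_smul, LinearMap.sub_apply, LinearMap.smul_apply, smul_eq_mul, hwa, mul_one,
      sub_self]
  have := Submodule.add_mem _ hx1 (Submodule.smul_mem _ (B x a) hwS)
  rwa [sub_add_cancel] at this

/-- **Rank-one step.** If `𝔤 ⊇ so(V₀)` contains a fully off-diagonal `g` whose values on an
orthogonal basis `e₁, e₂` of `V₁` are `a ≠ 0` and `t a`, then `𝔤` contains all wedges
`x ∧ e'`, `x ∈ V₀`, for the non-zero vector `e' = e₁ + (q₁ t / q₂) e₂` of `V₁`. [folklore] -/
theorem bwedge_mem_of_rank_one (hB : B.IsSymm) (hBn : B.Nondegenerate)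
    (hV₁ : ∀ v ∈ V₁, B v v = 0 → v = 0) (h2 : finrank 𝕜 V₁ = 2) (h5 : 5 ≤ finrank 𝕜 V)
    {𝔤 : LieSubalgebra 𝕜 (Module.End 𝕜 V)}
    (hann : ∀ f ∈ skewAdjointLieSubalgebra B, (∀ v ∈ V₁, f v = 0) → f ∈ 𝔤)
    {g : Module.End 𝕜 V} (hg : g ∈ 𝔤) (hgs : g ∈ skewAdjointLieSubalgebra B)
    (hg0 : ∀ v ∈ B.orthogonal V₁, g v ∈ V₁) (hg1 : ∀ e ∈ V₁, g e ∈ B.orthogonal V₁)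
    {e₁ e₂ : V} (he₁ : e₁ ∈ V₁) (he₂ : e₂ ∈ V₁) (he₂0 : e₂ ≠ 0) (h12 : B e₁ e₂ = 0)
    (hge₁ : g e₁ ≠ 0) {t : 𝕜} (hge₂ : g e₂ = t • g e₁) :
    ∀ x ∈ B.orthogonal V₁,
      (ω⟦B; x, e₁ + (B e₁ e₁ * t * (B e₂ e₂)⁻¹) • e₂⟧ : Module.End 𝕜 V) ∈ 𝔤 := by
  have he₁0 : e₁ ≠ 0 := fun h => hge₁ (by rw [h, map_zero])
  have hq₁ : B e₁ e₁ ≠ 0 := fun h => he₁0 (hV₁ e₁ he₁ h)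
  set e' := e₁ + (B e₁ e₁ * t * (B e₂ e₂)⁻¹) • e₂ with he'_def
  have he' : e' ∈ V₁ := Submodule.add_mem _ he₁ (Submodule.smul_mem _ _ he₂)
  let L : V →ₗ[𝕜] Module.End 𝕜 V :=
    { toFun := fun x => ω⟦B; x, e'⟧
      map_add' := fun x y => bwedge_add_left B x y e'
      map_smul' := fun c x => bwedge_smul_left B c x e' }
  let S : Submodule 𝕜 V := 𝔤.toSubmodule.comap L
  have hS : ∀ x, x ∈ S ↔ (ω⟦B; x, e'⟧ : Module.End 𝕜 V) ∈ 𝔤 := fun x => Iff.rfl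
  suffices hle : B.orthogonal V₁ ≤ S from fun x hx => (hS x).1 (hle hx)
  refine orthogonal_le_of_stable hB hBn hV₁ h2 h5 S (hg1 e₁ he₁) hge₁
    (fun u hu w hw => ?_) (fun u hu w hw x hx => ?_)
  · -- `(u ∧ w)(g e₁) ∈ S`: the bracket `k = [u ∧ w, g] ∈ 𝔤` has `(g e₁ ∧ e') = q₁ • k`... via `rep`
    obtain ⟨hks, hk0, hk1, hkv⟩ := lie_bwedge_off hB hgs hg0 hu hw
    have hk : ⁅(ω⟦B; u, w⟧ : Module.End 𝕜 V), g⁆ ∈ 𝔤 := 𝔤.lie_mem (bwedge_mem hB hann hu hw) hg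
    set k := ⁅(ω⟦B; u, w⟧ : Module.End 𝕜 V), g⁆ with hk_def
    have hrep := eq_bwedge_add_bwedge hB hV₁ h2 hks hk0 hk1 he₁ he₁0 he₂ he₂0 h12
    have hke₁ : k e₁ = (ω⟦B; u, w⟧ : Module.End 𝕜 V) (g e₁) := hkv e₁ he₁
    have hke₂ : k e₂ = t • (ω⟦B; u, w⟧ : Module.End 𝕜 V) (g e₁) := by
      rw [hkv e₂ he₂, hge₂, map_smul]
    rw [hS]
    have : (ω⟦B; (ω⟦B; u, w⟧ : Module.End 𝕜 V) (g e₁), e'⟧ : Module.End 𝕜 V) =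
        (B e₁ e₁) • k := by
      rw [hrep, hke₁, hke₂, he'_def, bwedge_add_right, bwedge_smul_right, bwedge_smul_left,
        smul_add, smul_smul, smul_smul, mul_inv_cancel₀ hq₁, one_smul]
      congr 1
      rw [smul_smul]
      ring_nf
    rw [this]
    exact 𝔤.smul_mem _ hk
  · -- stability: `[u ∧ w, x ∧ e'] = ((u ∧ w) x) ∧ e'`
    rw [hS] at hx ⊢
    have hY : (ω⟦B; u, w⟧ : Module.End 𝕜 V) ∈ 𝔤 := bwedge_mem hB hann hu hw
    have := 𝔤.lie_mem hY hx
    rwa [lie_bwedge (bwedge_skew hB u w), bwedge_apply_of_mem hB hu hw he',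
      show (ω⟦B; x, (0 : V)⟧ : Module.End 𝕜 V) = 0 by
        ext y; simp, add_zero] at this


omit [FiniteDimensional 𝕜 V] in
/-- `0 ∧ w = 0`. [folklore] -/
theorem bwedge_zero_left (B : LinearMap.BilinForm 𝕜 V) (w : V) :
    (ω⟦B; (0 : V), w⟧ : Module.End 𝕜 V) = 0 := by
  ext y; simp

omit [FiniteDimensional 𝕜 V] in
/-- `u ∧ 0 = 0`. [folklore] -/
theorem bwedge_zero_right (B : LinearMap.BilinForm 𝕜 V) (u : V) :
    (ω⟦B; u, (0 : V)⟧ : Module.End 𝕜 V) = 0 := by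
  ext y; simp

section Proj2

variable {π₀ : Module.End 𝕜 V}

omit [FiniteDimensional 𝕜 V] in
/-- A wedge of `V₀` only sees the `V₀`-component. [folklore] -/
theorem bwedge_apply_eq_proj (hB : B.IsSymm) (hπb : ∀ x, x - π₀ x ∈ V₁) {u w : V}
    (hu : u ∈ B.orthogonal V₁) (hw : w ∈ B.orthogonal V₁) (x : V) :
    (ω⟦B; u, w⟧ : Module.End 𝕜 V) x = (ω⟦B; u, w⟧ : Module.End 𝕜 V) (π₀ x) := by
  have := bwedge_apply_of_mem hB hu hw (hπb x)
  rwa [map_sub, sub_eq_zero] at this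

/-- **Removing the off-diagonal part.** For a skew `h` mapping `V₀` into `V₁` and an orthogonal
basis `e₁, e₂` of `V₁`, subtracting the two wedges `qᵢ⁻¹ (π₀ (h eᵢ) ∧ eᵢ)` leaves a rotation
(skew, killing `V₀`), whose values on `e₁, e₂` are the `V₁`-components of `h e₁, h e₂`. [folklore] -/
theorem sub_bwedges_rot (hB : B.IsSymm) (hV₁ : ∀ v ∈ V₁, B v v = 0 → v = 0)
    (h2 : finrank 𝕜 V₁ = 2) (hπa : ∀ x, π₀ x ∈ B.orthogonal V₁) (hπb : ∀ x, x - π₀ x ∈ V₁)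
    {h : Module.End 𝕜 V} (hh : h ∈ skewAdjointLieSubalgebra B)
    (hh0 : ∀ v ∈ B.orthogonal V₁, h v ∈ V₁) {e₁ e₂ : V} (he₁ : e₁ ∈ V₁) (he₁0 : e₁ ≠ 0)
    (he₂ : e₂ ∈ V₁) (he₂0 : e₂ ≠ 0) (h12 : B e₁ e₂ = 0) :
    h - ((B e₁ e₁)⁻¹ • ω⟦B; π₀ (h e₁), e₁⟧ + (B e₂ e₂)⁻¹ • ω⟦B; π₀ (h e₂), e₂⟧) ∈
        skewAdjointLieSubalgebra B ∧
    (∀ v ∈ B.orthogonal V₁,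
      (h - ((B e₁ e₁)⁻¹ • ω⟦B; π₀ (h e₁), e₁⟧ + (B e₂ e₂)⁻¹ • ω⟦B; π₀ (h e₂), e₂⟧)) v = 0) ∧
    (h - ((B e₁ e₁)⁻¹ • ω⟦B; π₀ (h e₁), e₁⟧ + (B e₂ e₂)⁻¹ • ω⟦B; π₀ (h e₂), e₂⟧)) e₁ =
      h e₁ - π₀ (h e₁) ∧
    (h - ((B e₁ e₁)⁻¹ • ω⟦B; π₀ (h e₁), e₁⟧ + (B e₂ e₂)⁻¹ • ω⟦B; π₀ (h e₂), e₂⟧)) e₂ =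
      h e₂ - π₀ (h e₂) := by
  set o : Module.End 𝕜 V :=
    (B e₁ e₁)⁻¹ • ω⟦B; π₀ (h e₁), e₁⟧ + (B e₂ e₂)⁻¹ • ω⟦B; π₀ (h e₂), e₂⟧ with ho
  have hq₁ : B e₁ e₁ ≠ 0 := fun h0 => he₁0 (hV₁ e₁ he₁ h0)
  have hq₂ : B e₂ e₂ ≠ 0 := fun h0 => he₂0 (hV₁ e₂ he₂ h0)
  have h21 : B e₂ e₁ = 0 := by rw [hB.eq]; exact h12
  have hos : o ∈ skewAdjointLieSubalgebra B :=
    (skewAdjointLieSubalgebra B).add_mem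
      ((skewAdjointLieSubalgebra B).smul_mem _
        ((mem_skewAdjointLieSubalgebra_iff B _).2 (bwedge_skew hB _ _)))
      ((skewAdjointLieSubalgebra B).smul_mem _
        ((mem_skewAdjointLieSubalgebra_iff B _).2 (bwedge_skew hB _ _)))
  have hoe₁ : o e₁ = π₀ (h e₁) := by
    rw [ho, LinearMap.add_apply, LinearMap.smul_apply, LinearMap.smul_apply, bwedge_apply,
      bwedge_apply, B_eq_zero_of_mem_orthogonal_of_mem hB he₁ (hπa _),
      B_eq_zero_of_mem_orthogonal_of_mem hB he₁ (hπa _), h21]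
    simp only [zero_smul, sub_zero, smul_zero, add_zero, smul_smul, inv_mul_cancel₀ hq₁, one_smul]
  have hoe₂ : o e₂ = π₀ (h e₂) := by
    rw [ho, LinearMap.add_apply, LinearMap.smul_apply, LinearMap.smul_apply, bwedge_apply,
      bwedge_apply, B_eq_zero_of_mem_orthogonal_of_mem hB he₂ (hπa _),
      B_eq_zero_of_mem_orthogonal_of_mem hB he₂ (hπa _), h12]
    simp only [zero_smul, sub_zero, smul_zero, zero_add, smul_smul, inv_mul_cancel₀ hq₂, one_smul]
  have hval₁ : (h - o) e₁ = h e₁ - π₀ (h e₁) := by rw [LinearMap.sub_apply, hoe₁]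
  have hval₂ : (h - o) e₂ = h e₂ - π₀ (h e₂) := by rw [LinearMap.sub_apply, hoe₂]
  have hoff' : ∀ v ∈ B.orthogonal V₁, (h - o) v ∈ V₁ := fun v hv => by
    rw [LinearMap.sub_apply, ho, LinearMap.add_apply, LinearMap.smul_apply, LinearMap.smul_apply,
      bwedge_apply, bwedge_apply, B_eq_zero_of_mem_of_mem_orthogonal he₁ hv,
      B_eq_zero_of_mem_of_mem_orthogonal he₂ hv, zero_smul, zero_smul, zero_sub, zero_sub]
    exact Submodule.sub_mem _ (hh0 v hv) (Submodule.add_mem _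
      (Submodule.smul_mem _ _ (Submodule.neg_mem _ (Submodule.smul_mem _ _ he₁)))
      (Submodule.smul_mem _ _ (Submodule.neg_mem _ (Submodule.smul_mem _ _ he₂))))
  have hstab : ∀ x ∈ V₁, (h - o) x ∈ V₁ := fun x hx => by
    rw [eq_smul_add_smul hB hV₁ h2 he₁ he₁0 he₂ he₂0 h12 hx, map_add, map_smul, map_smul, hval₁,
      hval₂]
    exact Submodule.add_mem _ (Submodule.smul_mem _ _ (hπb _)) (Submodule.smul_mem _ _ (hπb _))
  exact ⟨(skewAdjointLieSubalgebra B).sub_mem hh hos,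
    apply_eq_zero_of_off_of_stable hV₁ ((skewAdjointLieSubalgebra B).sub_mem hh hos) hoff' hstab,
    hval₁, hval₂⟩

end Proj2

end Setting

end SkewPlane

/-! ## The classification -/

section Main

variable [FiniteDimensional 𝕜 V] {B : LinearMap.BilinForm 𝕜 V} {V₁ : Submodule 𝕜 V}

open SkewPlane

/-- **Lie subalgebras of `𝔰𝔬(V)` containing `𝔰𝔬(V₀)`** (Verbitsky, erratum §2.1). Let `B` be a
non-degenerate symmetric bilinear form on a finite-dimensional space `V` over a field of
characteristic `≠ 2`, `V₁ ⊆ V` an ANISOTROPIC plane (`B(v,v) = 0 ⇒ v = 0` on `V₁`; e.g. a positive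
definite plane over `ℝ`) with `dim V ≥ 5` (so `dim V₀ ≥ 3`, `V₀ = V₁^⊥`), and let
`𝔰𝔬(V₀) ⊆ 𝔰𝔬(V)` be the skew endomorphisms killing `V₁` (they preserve `V₀` and act there as
`𝔰𝔬(V₀)`). Then every Lie subalgebra `𝔤` with `𝔰𝔬(V₀) ⊆ 𝔤 ⊆ 𝔰𝔬(V)` is one of:
`𝔰𝔬(V₀)`; `𝔰𝔬(V₀) ⊕ 𝔰𝔬(V₁)` (the skew maps preserving `V₁`); `𝔰𝔬(V₂)` for a hyperplane
`V₀ ⊊ V₂ = s^⊥ ⊊ V` (`s ∈ V₁ ∖ 0`; the skew maps killing `s`); or `𝔰𝔬(V)`.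
Printed form: "Consider a proper Lie subalgebra `𝔤 ⊊ 𝔰𝔬(V)` such that `𝔰𝔬(V₀) ⊊ 𝔤 ⊊ 𝔰𝔬(V)`.
Then either `𝔤 = 𝔰𝔬(V₂)`, where `V₂ ⊂ V` is a `p+q−1`-dimensional subspace, `V₀ ⊊ V₂ ⊊ V`, or
`𝔤 = 𝔰𝔬(V₀) ⊕ 𝔰𝔬(V₁)`" (`V₁` a positive 2-plane of `V = ℝ^{p,q}`); the case list with the two
extreme terms is the same statement. This is the algebraic step of the classification of the
closed connected subgroups `SO⁺(a−2,b) ⊆ S ⊆ SO⁺(a,b)` behind the orbit-closure trichotomy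
`Literature.Dynamics.Homogeneous.Verbitsky2017_orbitClosure_trichotomy_K3` (the intermediate group
`SO(V₂)` is exactly the one missed in the 2015 paper). The proof is the printed one made
elementary: the `𝔰𝔬(V₀)`-module `V₀ ⊗ V₁ ≅ V₀ ⊕ V₀` has only the submodules `V₀ ⊗ R₁`
(irreducibility of `V₀`, here `SkewPlane.orthogonal_le_of_stable`), and bracket closure sorts the
cases.
[cite: Verbitsky2017ErgodicErratum, §2.1 (Proposition and its two-step proof)] -/
theorem Verbitsky2017_lieSubalgebra_containing_so_orthogonal [NeZero (2 : 𝕜)] (hB : B.IsSymm)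
    (hBn : B.Nondegenerate) (hV₁ : ∀ v ∈ V₁, B v v = 0 → v = 0) (h2 : finrank 𝕜 V₁ = 2)
    (h5 : 5 ≤ finrank 𝕜 V) (𝔤 : LieSubalgebra 𝕜 (Module.End 𝕜 V))
    (hso : ∀ f ∈ 𝔤, f ∈ skewAdjointLieSubalgebra B)
    (hann : ∀ f ∈ skewAdjointLieSubalgebra B, (∀ v ∈ V₁, f v = 0) → f ∈ 𝔤) :
    (∀ f, f ∈ 𝔤 ↔ f ∈ skewAdjointLieSubalgebra B ∧ ∀ v ∈ V₁, f v = 0) ∨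
    (∀ f, f ∈ 𝔤 ↔ f ∈ skewAdjointLieSubalgebra B ∧ ∀ v ∈ V₁, f v ∈ V₁) ∨
    (∃ s ∈ V₁, s ≠ 0 ∧ ∀ f, f ∈ 𝔤 ↔ f ∈ skewAdjointLieSubalgebra B ∧ f s = 0) ∨
    (∀ f, f ∈ 𝔤 ↔ f ∈ skewAdjointLieSubalgebra B) := by
  classical
  -- the projection onto `V₀` along `V₁`
  have hc := isCompl_orthogonal_of_anisotropic hB hV₁
  set π₀ : Module.End 𝕜 V := (B.orthogonal V₁).projection V₁ hc.symm with hπ₀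
  have hπa : ∀ x, π₀ x ∈ B.orthogonal V₁ := fun x => Submodule.projection_apply_mem hc.symm x
  have hπb : ∀ x, x - π₀ x ∈ V₁ := fun x => by
    rw [hπ₀, Submodule.projection_eq_self_sub_projection hc x, sub_sub_cancel]
    exact Submodule.projection_apply_mem hc x
  have h3 := three_le_finrank_orthogonal hBn h2 h5
  -- generic decomposition data of a skew `f`
  have hdec : ∀ f ∈ skewAdjointLieSubalgebra B,
      π₀ * f * π₀ ∈ 𝔤 ∧ f - π₀ * f * π₀ ∈ skewAdjointLieSubalgebra B ∧
      (∀ v ∈ B.orthogonal V₁, (f - π₀ * f * π₀) v ∈ V₁) ∧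
      ∀ e ∈ V₁, (f - π₀ * f * π₀) e = f e := fun f hf =>
    ⟨hann _ (diag_mem hB hV₁ hπa hπb hf).1 (diag_mem hB hV₁ hπa hπb hf).2,
      (skewAdjointLieSubalgebra B).sub_mem hf (diag_mem hB hV₁ hπa hπb hf).1,
      (off_of_sub_diag hB hV₁ hπa hπb f).1, (off_of_sub_diag hB hV₁ hπa hπb f).2⟩
  by_cases hE : ∃ e' ∈ V₁, e' ≠ 0 ∧ ∀ x ∈ B.orthogonal V₁, (ω⟦B; x, e'⟧ : Module.End 𝕜 V) ∈ 𝔤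
  · obtain ⟨e', he', he'0, hEe'⟩ := hE
    obtain ⟨s, hs, hs0, hes⟩ := exists_orthogonal_mem (B := B) h2 e'
    have hq' : B e' e' ≠ 0 := fun h => he'0 (hV₁ e' he' h)
    have hqs : B s s ≠ 0 := fun h => hs0 (hV₁ s hs h)
    have hse : B s e' = 0 := by rw [hB.eq]; exact hes
    by_cases hE2 : ∀ x ∈ B.orthogonal V₁, (ω⟦B; x, s⟧ : Module.End 𝕜 V) ∈ 𝔤
    · -- ### `𝔤 = 𝔰𝔬(V)`
      refine Or.inr (Or.inr (Or.inr fun f => ⟨hso f, fun hf => ?_⟩))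
      -- the rotation `e' ∧ s` lies in `𝔤`
      obtain ⟨u, hu, huu⟩ := exists_anisotropic_mem_orthogonal hB hBn hV₁ h2 h5
      have hrot : (ω⟦B; e', s⟧ : Module.End 𝕜 V) ∈ 𝔤 := by
        have h1 := 𝔤.lie_mem (hEe' u hu) (hE2 u hu)
        rw [bwedge_lie_bwedge hB (B_eq_zero_of_mem_orthogonal_of_mem hB hs hu)
          (B_eq_zero_of_mem_of_mem_orthogonal he' hu), hes, neg_zero, zero_smul, zero_sub] at h1
        have h2' := 𝔤.smul_mem (-(B u u)⁻¹) h1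
        rwa [smul_neg, neg_smul, neg_neg, smul_smul, inv_mul_cancel₀ huu, one_smul] at h2'
      have hrots : (ω⟦B; e', s⟧ : Module.End 𝕜 V) ∈ skewAdjointLieSubalgebra B :=
        (mem_skewAdjointLieSubalgebra_iff B _).2 (bwedge_skew hB _ _)
      have hrot0 : ∀ v ∈ B.orthogonal V₁, (ω⟦B; e', s⟧ : Module.End 𝕜 V) v = 0 := fun v hv => by
        rw [bwedge_apply, B_eq_zero_of_mem_of_mem_orthogonal hs hv,
          B_eq_zero_of_mem_of_mem_orthogonal he' hv, zero_smul, zero_smul, sub_zero]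
      have hrotne : (ω⟦B; e', s⟧ : Module.End 𝕜 V) ≠ 0 := fun h0 => by
        have := LinearMap.congr_fun h0 e'
        rw [bwedge_apply, hse, zero_smul, zero_sub, LinearMap.zero_apply, neg_eq_zero,
          smul_eq_zero] at this
        exact this.elim hq' hs0
      obtain ⟨hDmem, hf₁, hoff0, hoff1⟩ := hdec f hf
      obtain ⟨hr, hr0, -, -⟩ := sub_bwedges_rot hB hV₁ h2 hπa hπb hf₁ hoff0 he' he'0 hs hs0 hes
      obtain ⟨c, hc'⟩ := exists_rot_eq_smul hB hBn hV₁ h2 hrots hrot0 hrotne hr hr0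
      have ho : (B e' e')⁻¹ • (ω⟦B; π₀ ((f - π₀ * f * π₀) e'), e'⟧ : Module.End 𝕜 V) +
          (B s s)⁻¹ • (ω⟦B; π₀ ((f - π₀ * f * π₀) s), s⟧ : Module.End 𝕜 V) ∈ 𝔤 :=
        𝔤.add_mem (𝔤.smul_mem _ (hEe' _ (hπa _))) (𝔤.smul_mem _ (hE2 _ (hπa _)))
      have key := 𝔤.add_mem (𝔤.add_mem hDmem ho) (hc' ▸ 𝔤.smul_mem c hrot)
      convert key using 1
      abel
    · -- ### `𝔤 = 𝔰𝔬(s^⊥)`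
      refine Or.inr (Or.inr (Or.inl ⟨s, hs, hs0, fun f => ⟨fun hf => ⟨hso f hf, ?_⟩,
        fun hf => ?_⟩⟩))
      · -- `f ∈ 𝔤 ⇒ f s = 0`
        obtain ⟨hDmem, hf₁s, hoff0, hoff1⟩ := hdec f (hso f hf)
        have hf₁ : f - π₀ * f * π₀ ∈ 𝔤 := 𝔤.sub_mem hf hDmem
        -- Step 1: the `V₀`-component of `f s` vanishes
        have hb : π₀ (f s) = 0 := by
          by_contra hb0
          obtain ⟨w, hw, hwb⟩ := exists_B_eq_one hB hBn hV₁ (hπa _) hb0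
          obtain ⟨u, hu, hu0, hub⟩ := exists_ne_zero_mem_ker₁ (B.orthogonal V₁) (by omega)
            (B (π₀ (f s)))
          have hYb : (ω⟦B; u, w⟧ : Module.End 𝕜 V) (π₀ (f s)) = u := by
            rw [bwedge_apply, hwb, hB.eq u, hub, one_smul, zero_smul, sub_zero]
          obtain ⟨hks, hk0, hk1, hkv⟩ := lie_bwedge_off hB hf₁s hoff0 hu hw
          have hk : ⁅(ω⟦B; u, w⟧ : Module.End 𝕜 V), f - π₀ * f * π₀⁆ ∈ 𝔤 :=
            𝔤.lie_mem (bwedge_mem hB hann hu hw) hf₁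
          set k := ⁅(ω⟦B; u, w⟧ : Module.End 𝕜 V), f - π₀ * f * π₀⁆ with hk_def
          -- remove the `e'`-component of `k`
          set k' : Module.End 𝕜 V := k - (B e' e')⁻¹ • ω⟦B; k e', e'⟧ with hk'_def
          have hk' : k' ∈ 𝔤 := 𝔤.sub_mem hk (𝔤.smul_mem _ (hEe' _ (hk1 e' he')))
          have hk's : k' ∈ skewAdjointLieSubalgebra B :=
            (skewAdjointLieSubalgebra B).sub_mem hks ((skewAdjointLieSubalgebra B).smul_mem _
              ((mem_skewAdjointLieSubalgebra_iff B _).2 (bwedge_skew hB _ _)))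
          have hk'0 : ∀ v ∈ B.orthogonal V₁, k' v ∈ V₁ := fun v hv => by
            rw [hk'_def, LinearMap.sub_apply, LinearMap.smul_apply, bwedge_apply,
              B_eq_zero_of_mem_of_mem_orthogonal he' hv, zero_smul, zero_sub]
            exact Submodule.sub_mem _ (hk0 v hv)
              (Submodule.smul_mem _ _ (Submodule.neg_mem _ (Submodule.smul_mem _ _ he')))
          have hk'1 : ∀ e ∈ V₁, k' e ∈ B.orthogonal V₁ := fun e he => by
            rw [hk'_def, LinearMap.sub_apply, LinearMap.smul_apply, bwedge_apply,
              B_eq_zero_of_mem_orthogonal_of_mem hB he (hk1 e' he'), zero_smul, sub_zero]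
            exact Submodule.sub_mem _ (hk1 e he)
              (Submodule.smul_mem _ _ (Submodule.smul_mem _ _ (hk1 e' he')))
          have hk'e' : k' e' = 0 := by
            rw [hk'_def, LinearMap.sub_apply, LinearMap.smul_apply, bwedge_apply,
              B_eq_zero_of_mem_orthogonal_of_mem hB he' (hk1 e' he'), zero_smul, sub_zero,
              smul_smul, inv_mul_cancel₀ hq', one_smul, sub_self]
          have hk's_val : k' s = u := by
            rw [hk'_def, LinearMap.sub_apply, LinearMap.smul_apply, bwedge_apply, hes,
              B_eq_zero_of_mem_orthogonal_of_mem hB hs (hk1 e' he'), zero_smul, zero_smul,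
              sub_zero, smul_zero, sub_zero, hkv s hs, hoff1 s hs,
              bwedge_apply_eq_proj hB hπb hu hw, hYb]
          have := bwedge_mem_of_rank_one hB hBn hV₁ h2 h5 hann hk' hk's hk'0 hk'1 hs he' he'0
            hse (by rw [hk's_val]; exact hu0) (t := 0) (by rw [hk'e', zero_smul])
          exact hE2 fun x hx => by
            have h := this x hx
            rwa [mul_zero, zero_mul, zero_smul, add_zero] at h
        -- Step 2: `f s ∈ V₁`; if non-zero, `𝔤` contains a rotation moving `e'` off its line
        by_contra hfs0
        obtain ⟨hr, hr0, hre', hrs⟩ :=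
          sub_bwedges_rot hB hV₁ h2 hπa hπb hf₁s hoff0 he' he'0 hs hs0 hes
        have hπfs : π₀ ((f - π₀ * f * π₀) s) = 0 := by rw [hoff1 s hs, hb]
        set r := f - π₀ * f * π₀ - ((B e' e')⁻¹ • ω⟦B; π₀ ((f - π₀ * f * π₀) e'), e'⟧ +
          (B s s)⁻¹ • ω⟦B; π₀ ((f - π₀ * f * π₀) s), s⟧) with hr_def
        have hr𝔤 : r ∈ 𝔤 := by
          refine 𝔤.sub_mem hf₁ (𝔤.add_mem (𝔤.smul_mem _ (hEe' _ (hπa _))) ?_)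
          rw [hπfs, bwedge_zero_left, smul_zero]
          exact 𝔤.zero_mem
        have hrs' : r s = f s := by rw [hrs, hπfs, sub_zero, hoff1 s hs]
        have hr' := (mem_skewAdjointLieSubalgebra_iff B r).1 hr
        have hre'V : r e' ∈ V₁ := apply_mem_of_rot hB hBn hr hr0 he'
        have hexp := eq_smul_add_smul hB hV₁ h2 he' he'0 hs hs0 hes hre'V
        rw [B_apply_self_eq_zero hB hr e', mul_zero, zero_smul, zero_add] at hexp
        by_cases hc₂ : B s (r e') = 0
        · rw [hc₂, mul_zero, zero_smul] at hexp
          have := rot_eq_zero hB hBn hV₁ h2 hr hr0 he' he'0 hexp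
          apply hfs0
          rw [← hrs', this, LinearMap.zero_apply]
        · apply hE2
          intro x hx
          have h1 := 𝔤.lie_mem hr𝔤 (hEe' x hx)
          rw [lie_bwedge hr', hr0 x hx, bwedge_zero_left, zero_add, hexp, bwedge_smul_right] at h1
          have h2' := 𝔤.smul_mem ((B s s)⁻¹ * B s (r e'))⁻¹ h1
          rwa [smul_smul, inv_mul_cancel₀ (mul_ne_zero (inv_ne_zero hqs) hc₂), one_smul] at h2'
      · -- `f` skew with `f s = 0 ⇒ f ∈ 𝔤`
        obtain ⟨hf', hfs⟩ := hf
        obtain ⟨hDmem, hf₁s, hoff0, hoff1⟩ := hdec f hf'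
        obtain ⟨hr, hr0, -, hrs⟩ :=
          sub_bwedges_rot hB hV₁ h2 hπa hπb hf₁s hoff0 he' he'0 hs hs0 hes
        have hπfs : π₀ ((f - π₀ * f * π₀) s) = 0 := by rw [hoff1 s hs, hfs, map_zero]
        have ho : (B e' e')⁻¹ • (ω⟦B; π₀ ((f - π₀ * f * π₀) e'), e'⟧ : Module.End 𝕜 V) +
            (B s s)⁻¹ • (ω⟦B; π₀ ((f - π₀ * f * π₀) s), s⟧ : Module.End 𝕜 V) ∈ 𝔤 := by
          refine 𝔤.add_mem (𝔤.smul_mem _ (hEe' _ (hπa _))) ?_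
          rw [hπfs, bwedge_zero_left, smul_zero]
          exact 𝔤.zero_mem
        have hzero := rot_eq_zero hB hBn hV₁ h2 hr hr0 hs hs0
          (by rw [hrs, hπfs, sub_zero, hoff1 s hs, hfs])
        have key := 𝔤.add_mem hDmem ho
        rw [sub_eq_zero] at hzero
        convert key using 1
        rw [← hzero]
        abel
  · -- ### `E = 0`: every element of `𝔤` preserves `V₁`
    have hstab : ∀ f ∈ 𝔤, ∀ e ∈ V₁, f e ∈ V₁ := by
      intro f hf e he
      by_contra hnot
      obtain ⟨hDmem, hf₁s, hoff0, hoff1⟩ := hdec f (hso f hf)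
      have hf₁ : f - π₀ * f * π₀ ∈ 𝔤 := 𝔤.sub_mem hf hDmem
      have ha0 : π₀ (f e) ≠ 0 := fun h0 => hnot (by
        have := hπb (f e)
        rwa [h0, sub_zero] at this)
      have he0 : e ≠ 0 := fun h => ha0 (by rw [h, map_zero, map_zero])
      obtain ⟨z, hz, hz0, hez⟩ := exists_orthogonal_mem (B := B) h2 e
      have hze : B z e = 0 := by rw [hB.eq]; exact hez
      have hqe : B e e ≠ 0 := fun h => he0 (hV₁ e he h)
      by_cases hdep : ∃ t : 𝕜, π₀ (f z) = t • π₀ (f e)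
      · obtain ⟨t, ht⟩ := hdep
        obtain ⟨w, hw, hwa⟩ := exists_B_eq_one hB hBn hV₁ (hπa _) ha0
        obtain ⟨u, hu, hu0, hua⟩ := exists_ne_zero_mem_ker₁ (B.orthogonal V₁) (by omega)
          (B (π₀ (f e)))
        have hYa : (ω⟦B; u, w⟧ : Module.End 𝕜 V) (π₀ (f e)) = u := by
          rw [bwedge_apply, hwa, hB.eq u, hua, one_smul, zero_smul, sub_zero]
        obtain ⟨hks, hk0, hk1, hkv⟩ := lie_bwedge_off hB hf₁s hoff0 hu hw
        have hk : ⁅(ω⟦B; u, w⟧ : Module.End 𝕜 V), f - π₀ * f * π₀⁆ ∈ 𝔤 :=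
          𝔤.lie_mem (bwedge_mem hB hann hu hw) hf₁
        have hke : ⁅(ω⟦B; u, w⟧ : Module.End 𝕜 V), f - π₀ * f * π₀⁆ e = u := by
          rw [hkv e he, hoff1 e he, bwedge_apply_eq_proj hB hπb hu hw, hYa]
        have hkz : ⁅(ω⟦B; u, w⟧ : Module.End 𝕜 V), f - π₀ * f * π₀⁆ z = t • u := by
          rw [hkv z hz, hoff1 z hz, bwedge_apply_eq_proj hB hπb hu hw, ht, map_smul, hYa]
        have := bwedge_mem_of_rank_one hB hBn hV₁ h2 h5 hann hk hks hk0 hk1 he hz hz0 hez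
          (by rw [hke]; exact hu0) (t := t) (by rw [hke, hkz])
        refine hE ⟨e + (B e e * t * (B z z)⁻¹) • z, Submodule.add_mem _ he
          (Submodule.smul_mem _ _ hz), fun h0 => hqe ?_, this⟩
        have := congr_arg (B e) h0
        rwa [map_add, map_smul, hez, smul_eq_mul, mul_zero, add_zero, map_zero] at this
      · -- independent values: a wedge killing `π₀ (f e)` but not `π₀ (f z)`
        obtain ⟨w, hw, hwa, hwb⟩ : ∃ w ∈ B.orthogonal V₁, B w (π₀ (f e)) = 0 ∧
            B w (π₀ (f z)) ≠ 0 := by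
          by_contra hcon
          have hall : ∀ w ∈ B.orthogonal V₁, B w (π₀ (f e)) = 0 → B w (π₀ (f z)) = 0 :=
            fun w hw hwa => by
              by_contra h
              exact hcon ⟨w, hw, hwa, h⟩
          obtain ⟨wa, hwa', hwaa⟩ := exists_B_eq_one hB hBn hV₁ (hπa _) ha0
          refine hdep ⟨B wa (π₀ (f z)), ?_⟩
          refine sub_eq_zero.1 (eq_zero_of_mem_orthogonal_of_forall hB hBn hV₁
            (Submodule.sub_mem _ (hπa _) (Submodule.smul_mem _ _ (hπa _))) fun w hw => ?_)
          have h1 : B (w - B w (π₀ (f e)) • wa) (π₀ (f e)) = 0 := by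
            rw [map_sub, map_smul, LinearMap.sub_apply, LinearMap.smul_apply, smul_eq_mul, hwaa,
              mul_one, sub_self]
          have h2' := hall _ (Submodule.sub_mem _ hw (Submodule.smul_mem _ _ hwa')) h1
          rw [map_sub, map_smul, LinearMap.sub_apply, LinearMap.smul_apply, smul_eq_mul] at h2'
          rw [map_sub, map_smul, smul_eq_mul]
          linear_combination h2'
        have hw0 : w ≠ 0 := fun h => hwb (by rw [h, map_zero, LinearMap.zero_apply])
        obtain ⟨w', hw', hw'w⟩ := exists_B_eq_one hB hBn hV₁ hw hw0
        obtain ⟨u, hu, hu0, hua, huw'⟩ := exists_ne_zero_mem_ker₂ (B.orthogonal V₁) h3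
          (B (π₀ (f e))) (B w')
        have hY₀a : (ω⟦B; u, w⟧ : Module.End 𝕜 V) (π₀ (f e)) = 0 := by
          rw [bwedge_apply, hwa, hB.eq u, hua, zero_smul, zero_smul, sub_zero]
        have hY₀b : (ω⟦B; u, w⟧ : Module.End 𝕜 V) (π₀ (f z)) ≠ 0 := by
          intro h0
          rw [bwedge_apply] at h0
          have h1 := congr_arg (B w') h0
          rw [map_sub, map_smul, map_smul, smul_eq_mul, smul_eq_mul, huw', hw'w,
            mul_zero, zero_sub, mul_one, map_zero, neg_eq_zero] at h1
          rw [h1, zero_smul, sub_zero] at h0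
          exact hu0 ((smul_eq_zero.1 h0).resolve_left hwb)
        obtain ⟨hks, hk0, hk1, hkv⟩ := lie_bwedge_off hB hf₁s hoff0 hu hw
        have hk : ⁅(ω⟦B; u, w⟧ : Module.End 𝕜 V), f - π₀ * f * π₀⁆ ∈ 𝔤 :=
          𝔤.lie_mem (bwedge_mem hB hann hu hw) hf₁
        have hke : ⁅(ω⟦B; u, w⟧ : Module.End 𝕜 V), f - π₀ * f * π₀⁆ e = 0 := by
          rw [hkv e he, hoff1 e he, bwedge_apply_eq_proj hB hπb hu hw, hY₀a]
        have hkz : ⁅(ω⟦B; u, w⟧ : Module.End 𝕜 V), f - π₀ * f * π₀⁆ z ≠ 0 := by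
          rw [hkv z hz, hoff1 z hz, bwedge_apply_eq_proj hB hπb hu hw]
          exact hY₀b
        have := bwedge_mem_of_rank_one hB hBn hV₁ h2 h5 hann hk hks hk0 hk1 hz he he0 hze hkz
          (t := 0) (by rw [hke, zero_smul])
        refine hE ⟨z, hz, hz0, fun x hx => ?_⟩
        have h := this x hx
        rwa [mul_zero, zero_mul, zero_smul, add_zero] at h
    by_cases hA : ∀ f ∈ 𝔤, ∀ v ∈ V₁, f v = 0
    · -- ### `𝔤 = 𝔰𝔬(V₀)`
      exact Or.inl fun f => ⟨fun hf => ⟨hso f hf, hA f hf⟩, fun hf => hann f hf.1 hf.2⟩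
    · -- ### `𝔤 = 𝔰𝔬(V₀) ⊕ 𝔰𝔬(V₁)`
      obtain ⟨f₀, hf₀, v, hv, hv0⟩ : ∃ f₀ ∈ 𝔤, ∃ v ∈ V₁, f₀ v ≠ 0 := by
        by_contra hcon
        refine hA fun f hf v hv => ?_
        by_contra h
        exact hcon ⟨f, hf, v, hv, h⟩
      refine Or.inr (Or.inl fun f => ⟨fun hf => ⟨hso f hf, hstab f hf⟩, fun hf => ?_⟩)
      obtain ⟨hf', hfs⟩ := hf
      obtain ⟨hD₀mem, hj₀s, hoff₀0, hoff₀1⟩ := hdec f₀ (hso f₀ hf₀)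
      have hj₀ : f₀ - π₀ * f₀ * π₀ ∈ 𝔤 := 𝔤.sub_mem hf₀ hD₀mem
      have hj₀rot : ∀ w ∈ B.orthogonal V₁, (f₀ - π₀ * f₀ * π₀) w = 0 :=
        apply_eq_zero_of_off_of_stable hV₁ hj₀s hoff₀0 fun e he => by
          rw [hoff₀1 e he]; exact hstab f₀ hf₀ e he
      have hj₀ne : f₀ - π₀ * f₀ * π₀ ≠ 0 := fun h0 => hv0 (by
        have := LinearMap.congr_fun h0 v
        rwa [hoff₀1 v hv, LinearMap.zero_apply] at this)
      obtain ⟨hDmem, hh₁s, hoff0, hoff1⟩ := hdec f hf'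
      have hh₁rot : ∀ w ∈ B.orthogonal V₁, (f - π₀ * f * π₀) w = 0 :=
        apply_eq_zero_of_off_of_stable hV₁ hh₁s hoff0 fun e he => by
          rw [hoff1 e he]; exact hfs e he
      obtain ⟨c, hc'⟩ := exists_rot_eq_smul hB hBn hV₁ h2 hj₀s hj₀rot hj₀ne hh₁s hh₁rot
      have key := 𝔤.add_mem hDmem (hc' ▸ 𝔤.smul_mem c hj₀)
      convert key using 1
      abel


/-- **Verbitsky's erratum §2.1, printed form.** Under the hypotheses of
`Verbitsky2017_lieSubalgebra_containing_so_orthogonal`, a Lie subalgebra `𝔤` with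
`𝔰𝔬(V₀) ⊊ 𝔤 ⊊ 𝔰𝔬(V)` (PROPER containments: some element of `𝔤` moves `V₁`, and some skew
endomorphism is not in `𝔤`) is either `𝔰𝔬(V₂)` for the hyperplane `V₂ = s^⊥ ⊋ V₀` of a non-zero
`s ∈ V₁` (the skew maps killing `s`), or `𝔰𝔬(V₀) ⊕ 𝔰𝔬(V₁)` (the skew maps preserving `V₁`):
"Consider a proper Lie subalgebra `𝔤 ⊊ 𝔰𝔬(V)` such that `𝔰𝔬(V₀) ⊊ 𝔤 ⊊ 𝔰𝔬(V)`. Then either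
`𝔤 = 𝔰𝔬(V₂)`, where `V₂ ⊂ V` is a `p+q−1`-dimensional subspace, `V₀ ⊊ V₂ ⊊ V`, or
`𝔤 = 𝔰𝔬(V₀) ⊕ 𝔰𝔬(V₁)`."
[cite: Verbitsky2017ErgodicErratum, §2.1 (Proposition)] -/
theorem Verbitsky2017_properIntermediateSubalgebra [NeZero (2 : 𝕜)] (hB : B.IsSymm)
    (hBn : B.Nondegenerate) (hV₁ : ∀ v ∈ V₁, B v v = 0 → v = 0) (h2 : finrank 𝕜 V₁ = 2)
    (h5 : 5 ≤ finrank 𝕜 V) (𝔤 : LieSubalgebra 𝕜 (Module.End 𝕜 V))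
    (hso : ∀ f ∈ 𝔤, f ∈ skewAdjointLieSubalgebra B)
    (hann : ∀ f ∈ skewAdjointLieSubalgebra B, (∀ v ∈ V₁, f v = 0) → f ∈ 𝔤)
    (hlow : ∃ f ∈ 𝔤, ∃ v ∈ V₁, f v ≠ 0) (hup : ∃ f ∈ skewAdjointLieSubalgebra B, f ∉ 𝔤) :
    (∃ s ∈ V₁, s ≠ 0 ∧ ∀ f, f ∈ 𝔤 ↔ f ∈ skewAdjointLieSubalgebra B ∧ f s = 0) ∨
    (∀ f, f ∈ 𝔤 ↔ f ∈ skewAdjointLieSubalgebra B ∧ ∀ v ∈ V₁, f v ∈ V₁) := by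
  obtain ⟨f₀, hf₀, v, hv, hv0⟩ := hlow
  obtain ⟨f₁, hf₁, hf₁𝔤⟩ := hup
  rcases Verbitsky2017_lieSubalgebra_containing_so_orthogonal hB hBn hV₁ h2 h5 𝔤 hso hann with
    hA | hBc | hC | hD
  · exact (hv0 (((hA f₀).1 hf₀).2 v hv)).elim
  · exact Or.inr hBc
  · exact Or.inl hC
  · exact (hf₁𝔤 ((hD f₁).2 hf₁)).elim

end Main

end Literature.Dynamics.Homogeneous
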